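import Mathlib
import HarnessLib
import Summits.ValiantsHypothesis.ValiantsHypothesis.Theses.MonotoneRestoration
import Literature.Computability.AlgebraicComplexity.ArithCircuit
import Literature.Computability.AlgebraicComplexity.ArithCircuitProofs
import Literature.Computability.AlgebraicComplexity.MonotoneStructure
import Literature.Computability.AlgebraicComplexity.PermanentIrreducible
import Literature.ModelTheory.FiniteModelTheory.CkEquiv
import Summits.ValiantsHypothesis.ValiantsHypothesis.Theorems.MonotoneRestorationMonotoneRestorationQPCosetCount
import Summits.ValiantsHypothesis.ValiantsHypothesis.Theorems.MonotoneRestorationMonotoneRestorationQPSymmetricLB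
import Summits.ValiantsHypothesis.ValiantsHypothesis.Theorems.MonotoneRestorationMonotoneRestorationQPSupportSymmetrisation
import Summits.ValiantsHypothesis.ValiantsHypothesis.Theorems.MonotoneRestorationMonotoneRestorationQPSparseRegime
import Summits.ValiantsHypothesis.ValiantsHypothesis.Theorems.MonotoneRestorationMonotoneRestorationQPBeta
import Literature.Computability.AlgebraicComplexity.SymmetricArithCircuit
import Literature.Computability.AlgebraicComplexity.DawarWilsenach2025Proofs
import Literature.GroupTheory.PermutationGroups.SmallIndexSubgroups
import Summits.ValiantsHypothesis.ValiantsHypothesis.Theorems.MonotoneRestorationQP.Negative.LoadBearing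
import Summits.ValiantsHypothesis.ValiantsHypothesis.Theorems.MonotoneRestorationMonotoneRestorationQPPermSupportCount

/-! TTRL-lite variant V19053 of stmt-ValiantsHypothesis-15886

Move `drop_hyp` (`[n3_nosign_false]`): the stub `stub_altFixing_orbit_dichotomy` at the boundary
`n = 3`, `X = ∅`, `|T| < 3`, with the parity condition `sign ρ = 1` dropped on BOTH sides (orbit
hypothesis and conclusion now range over all of `Sym(Fin 3)`).  This variant is FALSE —
`Alt(Fin 3)` has index `2 < 3` in `Sym(Fin 3)`, so an `A₃`-invariant, non-symmetric polynomial has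
a full orbit of size `2` — and the negation is proved here by an explicit witness.
-/

-- `Summit.ValiantsHypothesis.ValiantsHypothesis.…` is the tree's mandated single-conjunct layout
-- (Sub = Summit), so the duplicated namespace component is intended.
set_option linter.dupNamespace false

namespace Summit.ValiantsHypothesis.ValiantsHypothesis.Theorems

open Summit.ValiantsHypothesis.ValiantsHypothesis.Theses.MonotoneRestoration
open Literature.Computability.AlgebraicComplexity

/-- **TTRL-lite variant V19053 of `stub_altFixing_orbit_dichotomy` is FALSE** (move `drop_hyp`,
`n = 3`, `X = ∅`, `|T| < 3`, parity `sign ρ = 1` dropped in hypothesis AND conclusion): without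
parity in the conclusion the orbit dichotomy fails, because `Alt(Fin 3)` is a subgroup of index
`2 < 3` of `Sym(Fin 3)`.

Witness: `K = ℕ`, `q = x_{01} + x_{12} + x_{20}` (the directed `3`-cycle `0 → 1 → 2 → 0`, written
as a sum over its set of ordered pairs — invariant under `A₃`, not under `S₃`), and
`T = {q, x_{10} + x_{21} + x_{02}}` (the two orientations), so `|T| ≤ 2 < 3`
(`Finset.card_le_two`).  Every permutation `ρ` of `Fin 3` maps the directed cycle to one of its
two orientations (a finite check on the triple `(ρ 0, ρ 1, ρ 2)`, `decide`), and `rename` of a sum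
of variables over a set of pairs is the sum over the image set (`Finset.sum_image`), so the whole
orbit of `q` lies in `T`; yet the transposition `ρ = (0 1)` reverses the orientation, sending `q`
to `x_{10} + x_{02} + x_{21} ≠ q` (evaluate at the indicator of the pair `(0, 1)`: `0 ≠ 1` in
`ℕ`). -/
theorem stub_altFixing_orbit_dichotomy_var19053_false :
    ¬ (∀ (K : Type) [CommSemiring K] (q : MvPolynomial (Fin 3 × Fin 3) K)
        (T : Finset (MvPolynomial (Fin 3 × Fin 3) K)), T.card < 3 →
        (∀ ρ : Equiv.Perm (Fin 3),
          MvPolynomial.rename (fun p : Fin 3 × Fin 3 => (ρ p.1, ρ p.2)) q ∈ T) →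
        ∀ ρ : Equiv.Perm (Fin 3),
          MvPolynomial.rename (fun p : Fin 3 × Fin 3 => (ρ p.1, ρ p.2)) q = q) := by
  intro h
  -- `P S = ∑_{p ∈ S} x_p`, kept opaque through `hP`
  obtain ⟨P, hP⟩ : ∃ P : Finset (Fin 3 × Fin 3) → MvPolynomial (Fin 3 × Fin 3) ℕ,
      ∀ S, P S = ∑ p ∈ S, MvPolynomial.X p := ⟨_, fun _ => rfl⟩
  -- relabelling a sum of variables = summing over the relabelled index set
  have hren : ∀ (ρ : Equiv.Perm (Fin 3)) (S : Finset (Fin 3 × Fin 3)),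
      MvPolynomial.rename (fun p : Fin 3 × Fin 3 => (ρ p.1, ρ p.2)) (P S)
        = P (S.image (fun p : Fin 3 × Fin 3 => (ρ p.1, ρ p.2))) := by
    intro ρ S
    rw [hP, hP, map_sum, Finset.sum_image]
    · simp only [MvPolynomial.rename_X]
    · intro x _ y _ hxy
      simp only [Prod.mk.injEq] at hxy
      exact Prod.ext (ρ.injective hxy.1) (ρ.injective hxy.2)
  -- the finite combinatorial core: a bijection of `Fin 3` preserves or reverses the orientation
  -- of the directed `3`-cycle `0 → 1 → 2 → 0`
  have key : ∀ a b c : Fin 3, a ≠ b → a ≠ c → b ≠ c →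
      ({(a, b), (b, c), (c, a)} : Finset (Fin 3 × Fin 3)) = {(0, 1), (1, 2), (2, 0)} ∨
      ({(a, b), (b, c), (c, a)} : Finset (Fin 3 × Fin 3)) = {(1, 0), (2, 1), (0, 2)} := by
    decide
  have himg : ∀ ρ : Equiv.Perm (Fin 3),
      ({(0, 1), (1, 2), (2, 0)} : Finset (Fin 3 × Fin 3)).image
          (fun p : Fin 3 × Fin 3 => (ρ p.1, ρ p.2)) = {(0, 1), (1, 2), (2, 0)} ∨
      ({(0, 1), (1, 2), (2, 0)} : Finset (Fin 3 × Fin 3)).image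
          (fun p : Fin 3 × Fin 3 => (ρ p.1, ρ p.2)) = {(1, 0), (2, 1), (0, 2)} := by
    intro ρ
    have hne : ∀ i j : Fin 3, i ≠ j → ρ i ≠ ρ j := fun i j hij hρ => hij (ρ.injective hρ)
    simp only [Finset.image_insert, Finset.image_singleton]
    exact key _ _ _ (hne 0 1 (by decide)) (hne 0 2 (by decide)) (hne 1 2 (by decide))
  -- hence the whole `Sym(Fin 3)`-orbit of `q = P {01, 12, 20}` lies in the two-element set `T`
  have hmem : ∀ ρ : Equiv.Perm (Fin 3),
      MvPolynomial.rename (fun p : Fin 3 × Fin 3 => (ρ p.1, ρ p.2))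
          (P {(0, 1), (1, 2), (2, 0)}) ∈
        ({P {(0, 1), (1, 2), (2, 0)}, P {(1, 0), (2, 1), (0, 2)}} :
          Finset (MvPolynomial (Fin 3 × Fin 3) ℕ)) := by
    intro ρ
    rw [hren]
    rcases himg ρ with h1 | h2
    · rw [h1]; simp
    · rw [h2]; simp
  have hcard : ({P {(0, 1), (1, 2), (2, 0)}, P {(1, 0), (2, 1), (0, 2)}} :
      Finset (MvPolynomial (Fin 3 × Fin 3) ℕ)).card < 3 :=
    lt_of_le_of_lt Finset.card_le_two (by norm_num)
  -- the transposition `(0 1)` reverses the orientation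
  have himg₀ : ({(0, 1), (1, 2), (2, 0)} : Finset (Fin 3 × Fin 3)).image
      (fun p : Fin 3 × Fin 3 => ((Equiv.swap (0 : Fin 3) 1 : Equiv.Perm (Fin 3)) p.1,
        (Equiv.swap (0 : Fin 3) 1 : Equiv.Perm (Fin 3)) p.2)) =
        {(1, 0), (2, 1), (0, 2)} := by
    decide
  -- specialise the (false) statement to the witness: the transposition would fix `q`
  have hfix := h ℕ _ _ hcard hmem (Equiv.swap (0 : Fin 3) 1)
  rw [hren, himg₀, hP, hP] at hfix
  -- evaluate both sides at the indicator of the pair `(0, 1)`: `0 = 1` in `ℕ`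
  have hev := congrArg
    (MvPolynomial.eval (fun p : Fin 3 × Fin 3 => if p = ((0 : Fin 3), (1 : Fin 3)) then (1 : ℕ) else 0))
    hfix
  simp [MvPolynomial.eval_X] at hev

end Summit.ValiantsHypothesis.ValiantsHypothesis.Theorems
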